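import Mathlib
import Summits.Ventures.PercRepro2.Inst8TypedK3
import Summits.Ventures.PercRepro2.Tri10Cert

/-!
# The `|F| = 10` four-mark unmarked triangle is a kernel theorem of row 2′TRI
(blind cell PercRepro2, typer-1 g14)

S4's named object that remains under the twenty flat conditions (S4-HARDSTEP v46; the smallest
unmarked part of record attached at `≥ 3` vertices): the unmarked triangle `u w x` with `u ~ o`,
`w ~ a₁`, `x ~ a₃`, `x ~ b` and the path `a₁ – o – a₂ – b` (`ends_tri10`).  From the kernel certificate
`cert_tri10` (`Tri10Cert.lean`) and the bridge `Inst8TypedK3.lean`: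

* **`typedBases_tri10`**: `CovForm.TypedBases (ends tri10) 0 1 2 3 4` — every typed three-copy count of
  `K₃` on every minor of the triangle instance, for every type map, is `≥ 0` (row 2′TRI on the instance);
* **`HCov_tri10`**: (HCOV) on the instance for every admissible weight vector;
* **`ZDelta_tri10`**: the crux of record `ZDelta` on the instance, for every admissible weight vector
  with `P(a₁ ↔ b) ≤ P(a₂ ↔ b)`.
-/

namespace Summit.Ventures.PercRepro2

namespace Inst8

/-- The triangle instance, edge by edge: `uw, wx, ux, ou, a₁w, a₃x, bx, oa₁, oa₂, a₂b` on the marks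
`o = 0, a₁ = 1, a₂ = 2, a₃ = 3, b = 4` and the unmarked `u = 5, w = 6, x = 7`. -/
lemma ends_tri10 :
    ends tri10 = ![s(5, 6), s(6, 7), s(5, 7), s(0, 5), s(1, 6), s(3, 7), s(4, 7), s(0, 1), s(0, 2),
      s(2, 4)] := by
  funext e
  fin_cases e <;> rfl

section Theorems

variable {R : Type*} [Field R] [LinearOrder R] [IsStrictOrderedRing R]

/-- **Row 2′TRI on the `|F| = 10` four-mark unmarked triangle**: every typed three-copy count of `K₃`
on every minor of the instance, for every type map, is nonnegative. -/
theorem typedBases_tri10 : CovForm.TypedBases (R := R) (ends tri10) 0 1 2 3 4 :=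
  typedBases_of_cert tri10 4 cert_tri10

/-- **(HCOV) on the triangle instance** for every admissible weight vector. -/
theorem HCov_tri10 (p : Fin 10 → R) (hp : IsProbVec p) : CovForm.HCov p (ends tri10) 0 1 2 3 4 :=
  HCov_of_cert tri10 4 cert_tri10 p hp

/-- **The crux of record on the triangle instance**: `ZDelta` for every admissible weight vector with
`P(a₁ ↔ b) ≤ P(a₂ ↔ b)`. -/
theorem ZDelta_tri10 (p : Fin 10 → R) (hp : IsProbVec p)
    (hord : prob p (connEvent (ends tri10) 1 4) ≤ prob p (connEvent (ends tri10) 2 4)) :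
    ZDelta p (ends tri10) 0 1 2 3 4 :=
  CovForm.ZDelta_of_typedBases (ends tri10) typedBases_tri10 p hp hord

end Theorems

end Inst8

end Summit.Ventures.PercRepro2
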